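import Summits.KontsevichZagierPeriods.KontsevichZagierPeriods.Theorems.SoloInformedToricCornerMove
import HarnessLib

/-!
# THEOREM MZV: the cubical multiple-zeta integrands `P/∏ₜ (1 − x₀⋯x_{dₜ−1})` on `[0,1]ⁿ`

Solo programme `solo-KontsevichZagierPeriods-informed`, session s104 (closure properties, 5).

The cubical representation of a multiple zeta value of weight `n` (prefix-product coordinates,
Zagier 1994 §9; `soloInformedCubeW` in this programme) has integrand
`xᵅ/∏_{t} (1 − x₀x₁⋯x_{dₜ−1})` on `[0,1]ⁿ`, e.g. `ζ(n) = ∫_{[0,1]ⁿ} dx/(1 − x₀⋯x_{n−1})` and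
`ζ(2,1) = ∫_{[0,1]³} x₀x₁ dx/((1 − x₀x₁)(1 − x₀x₁x₂))`.  These denominators vanish at the far
corner and are not cube-nondegenerate, but their reflections under the corner move `x ↦ 1 − x`
are the cube-nondegenerate factors `soloInformedMZVFactor` (`soloInformed_reflect_prefixFactor`).
By the corner move inside the calculus (`soloInformed_presentable_of_reflect_nondegenerate`):

* **THEOREM MZV** `soloInformed_presentable_mzvCubeOrig`: for all depths `0 < dₜ ≤ n` and every
  numerator `P ∈ ℚ[x]`, `[[0,1]ⁿ, P/∏ₜ (1 − ∏_{j<dₜ} xⱼ)]` is presentable (`k = 1`); open-cube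
  version `…_open`, crux format `soloInformed_cubeResolution_mzvCubeOrig`;
* `soloInformed_presentable_zetaOrig`: `[[0,1]ⁿ, P/(1 − x₀⋯x_{n−1})]` (`ζ(n)` itself for `P = 1`).

So the cube crux `SoloInformedAyoubCubeResolutionCube` holds, inside the KZ calculus, for the
standard cubical integral of every multiple zeta value.

References: D. Zagier, *Values of zeta functions and their applications* (1994) §9;
M. Kontsevich, D. Zagier, *Periods* (2001) §1.2; J. Ayoub, EMS Newsl. 91 (2014) §2.2.
-/

noncomputable section

open scoped BigOperators
open MeasureTheory Set
open Literature.NumberTheory.Transcendental Literature.NumberTheory.Transcendental.KZ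
open Literature.ModelTheory.ExponentialFields (IsSemialgebraic)

namespace Summit.KontsevichZagierPeriods.KontsevichZagierPeriods.Theorems

variable {n : ℕ}

/-- The reflected prefix denominator `reflect (1 − ∏_{j<i} xⱼ)` is the multiple-zeta factor
`F_i = 1 − ∏_{j<i} (1 − xⱼ)`. [this work] -/
theorem soloInformed_reflect_prefixFactor {i : ℕ} (h : i ≤ n) :
    soloInformedReflect n (1 - ∏ j : Fin i, MvPolynomial.X (Fin.castLE h j)) =
      soloInformedMZVFactor n i h := by
  unfold soloInformedMZVFactor soloInformedZetaDenominator
  rw [map_sub, map_one, map_prod]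
  simp only [soloInformed_reflect_X, map_sub, map_one, map_prod, MvPolynomial.rename_X]

/-- The reflected cubical multiple-zeta denominator `reflect (∏ₜ (1 − ∏_{j<dₜ} xⱼ)) = ∏ₜ F_{dₜ}` is
cube-nondegenerate. [this work] -/
theorem soloInformed_cubeNondegenerate_reflect_mzvOrig {k : ℕ} (d : Fin k → ℕ)
    (hd : ∀ t, 0 < d t ∧ d t ≤ n) :
    SoloInformedCubeNondegenerate (soloInformedReflect n
      (∏ t, (1 - ∏ j : Fin (d t), MvPolynomial.X (Fin.castLE (hd t).2 j)))) := by
  rw [map_prod]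
  exact soloInformed_cubeNondegenerate_prod Finset.univ _ fun t _ => by
    rw [soloInformed_reflect_prefixFactor]
    exact soloInformed_cubeNondegenerate_mzvFactor (hd t).1 (hd t).2

/-- **THEOREM MZV, open cube.**  For depths `0 < dₜ ≤ n` and any numerator `P`, every `IntegralRep`
with domain `(0,1)ⁿ` and integrand `P/∏ₜ (1 − ∏_{j<dₜ} xⱼ)` there is presentable. [this work] -/
theorem soloInformed_presentable_mzvCubeOrig_open {k : ℕ} (d : Fin k → ℕ)
    (hd : ∀ t, 0 < d t ∧ d t ≤ n) (P : MvPolynomial (Fin n) ℚ) (ρ : IntegralRep n)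
    (hρ : ρ.domain = soloInformedOpenCube n)
    (hρi : EqOn ρ.integrand (fun x => MvPolynomial.aeval x P /
      ∏ t, (1 - ∏ j : Fin (d t), x (Fin.castLE (hd t).2 j))) (soloInformedOpenCube n)) :
    of ρ ∈ soloInformedPresentable := by
  refine soloInformed_presentable_of_reflect_nondegenerate_open P
    (∏ t, (1 - ∏ j : Fin (d t), MvPolynomial.X (Fin.castLE (hd t).2 j)))
    (soloInformed_cubeNondegenerate_reflect_mzvOrig d hd) ρ hρ fun x hx => ?_
  rw [hρi hx]
  simp only [map_prod, map_sub, map_one, MvPolynomial.aeval_X]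

/-- **THEOREM MZV.**  For depths `0 < dₜ ≤ n` and any numerator `P ∈ ℚ[x₀, …, x_{n−1}]`, the cube
representation `[[0,1]ⁿ, P/∏ₜ (1 − x₀x₁⋯x_{dₜ−1})]` — the standard cubical integral of a multiple
zeta value for monomial `P` — is presentable: inside the KZ calculus it equals a `ℤ`-combination
of cube integrals of real parts of germs holomorphic near the closed cube. [this work] -/
theorem soloInformed_presentable_mzvCubeOrig {k : ℕ} (d : Fin k → ℕ)
    (hd : ∀ t, 0 < d t ∧ d t ≤ n) (P : MvPolynomial (Fin n) ℚ) (r : IntegralRep n)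
    (hr : r.domain = soloInformedCube n)
    (hri : EqOn r.integrand (fun x => MvPolynomial.aeval x P /
      ∏ t, (1 - ∏ j : Fin (d t), x (Fin.castLE (hd t).2 j))) (soloInformedOpenCube n)) :
    of r ∈ soloInformedPresentable := by
  refine soloInformed_presentable_of_reflect_nondegenerate P
    (∏ t, (1 - ∏ j : Fin (d t), MvPolynomial.X (Fin.castLE (hd t).2 j)))
    (soloInformed_cubeNondegenerate_reflect_mzvOrig d hd) r hr fun x hx => ?_
  rw [hri hx]
  simp only [map_prod, map_sub, map_one, MvPolynomial.aeval_X]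

/-- **THEOREM MZV in the output format of the cube crux** `SoloInformedAyoubCubeResolutionCube`.
[this work] -/
theorem soloInformed_cubeResolution_mzvCubeOrig {k : ℕ} (d : Fin k → ℕ)
    (hd : ∀ t, 0 < d t ∧ d t ≤ n) (P : MvPolynomial (Fin n) ℚ) (r : IntegralRep n)
    (hr : r.domain = soloInformedCube n)
    (hri : EqOn r.integrand (fun x => MvPolynomial.aeval x P /
      ∏ t, (1 - ∏ j : Fin (d t), x (Fin.castLE (hd t).2 j))) (soloInformedOpenCube n)) :
    ∃ (k' : ℕ) (_ : k' ≠ 0) (m : ℕ) (d' : Fin m → ℕ) (G : ∀ j, SoloInformedCubeGerm (d' j))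
      (c : Fin m → ℤ) (ρ : ∀ j, IntegralRep (d' j)),
      (∀ j, (ρ j).domain = soloInformedCube (d' j)) ∧
      (∀ j, EqOn (ρ j).integrand (fun x => ((G j).g (soloInformedToC (d' j) x)).re)
        (soloInformedCube (d' j))) ∧
      k' • of r - ∑ j, c j • of (ρ j) ∈ relations :=
  soloInformed_exists_fin_of_presentable (soloInformed_presentable_mzvCubeOrig d hd P r hr hri)

/-- **`ζ(n)` itself**: for `0 < n` and any numerator `P`, `[[0,1]ⁿ, P/(1 − x₀⋯x_{n−1})]` is
presentable (`P = 1` is the standard cube integral `ζ(n) = ∫_{[0,1]ⁿ} dx/(1 − x₀⋯x_{n−1})`).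
[this work] -/
theorem soloInformed_presentable_zetaOrig (hn : 0 < n) (P : MvPolynomial (Fin n) ℚ)
    (r : IntegralRep n) (hr : r.domain = soloInformedCube n)
    (hri : EqOn r.integrand (fun x => MvPolynomial.aeval x P / (1 - ∏ j, x j))
      (soloInformedOpenCube n)) :
    of r ∈ soloInformedPresentable := by
  have hrefl : soloInformedReflect n (1 - ∏ j, MvPolynomial.X j) = soloInformedZetaDenominator n := by
    unfold soloInformedZetaDenominator
    rw [map_sub, map_one, map_prod]
    simp only [soloInformed_reflect_X]
  refine soloInformed_presentable_of_reflect_nondegenerate P (1 - ∏ j, MvPolynomial.X j)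
    (hrefl ▸ soloInformed_cubeNondegenerate_zetaDenominator hn) r hr fun x hx => ?_
  rw [hri hx]
  simp only [map_prod, map_sub, map_one, MvPolynomial.aeval_X]

end Summit.KontsevichZagierPeriods.KontsevichZagierPeriods.Theorems
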